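import Summits.QuantumFields.YangMills.Theorems.LangevinControlUVFemtoCurvatureTwoPointCDefsCore

/-!
# Route `LangevinControlUV`, crux `FemtoCurvatureTwoPointC` (stmt-QuantumFields-16204): line `birth`, the variance bridge for stub V

Line birth reshape (lead c9, wave 1): V ⟸ u-free bare variance ceiling VB + bare size (from the R-bundle).

The birth skeleton `Cruxes/FemtoCurvatureTwoPointC/Lines/birth.lean` cuts the femto-engine statement `AFProfilesCoreAt r`
(`…CDefsCore`) into stubs R (an INTRINSIC asymptotic-freedom box coupling `u` which is BARE-SIZED, `c₈ ≤ β·u(8,β)` for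
`β ≥ β₀`, with `0 < c₈`), D, LU and V (the VARIANCE CEILING `Var_{L,β}(P_0^{01}) ≤ C'·u(8,β)²` of the plaquette observable
on window boxes `L ≥ 8` beyond a threshold). This file proves, sorry-free, the purely logical BRIDGE behind the lead's reshape
of V into a `u`-free statement:

* `varianceCeiling_of_bareVariance` — for a GIVEN coupling `u` carrying the R-bundle (hypothesis `hR`, verbatim the
  antecedent of the registered `stub_varianceCeiling`), the conclusion of V follows from the `u`-FREE BARE VARIANCE CEILING
  VB (hypothesis `hVB`): `Var_{L,β}(P_0^{01}) ≤ C₃/β²` for `β ≥ β₂`, `L ≥ 8`.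

Proof (pure real arithmetic, `variance_combine`). Witnesses: threshold `β₁ := max β₀ (max β₂ 1)`, constant
`C' := max C₃ 0 / c₈²`. For `β ≥ β₁` one has `β ≥ 1 > 0`, `β ≥ β₀` and `β ≥ β₂`. Squaring the bare size `c₈ ≤ β·u(8,β)`
(both sides non-negative since `0 < c₈`) gives `c₈² ≤ β²·u(8,β)²`, i.e. `1/β² ≤ u(8,β)²/c₈²`; hence
`Var ≤ C₃/β² ≤ (max C₃ 0)/β² ≤ (max C₃ 0)·u(8,β)²/c₈² = C'·u(8,β)²`. The window hypothesis of V is not used, and of `hR`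
only `0 < c₈` and the bare-size clause are used.

Design. Both hypotheses are kept CHARACTER FOR CHARACTER equal to the registered texts (the lead instantiates this theorem
with the registered stub bodies in the composition `afProfilesCoreAt_of_birth`). Nothing in this file is physics and nothing
is asserted unconditionally. Deliberately NOT here: VB itself (a `u`-free `O(1/β²)` bound on the plaquette variance,
uniformly in the volume), R, D, LU, and the even-torus variant of VB obtained from uniform torus doubling.
-/

set_option autoImplicit false

noncomputable section

open Filter Topology MeasureTheory
open Literature.MathematicalPhysics.QuantumFieldTheory

namespace Summit.QuantumFields.YangMills.Theorems.FemtoCurvatureTwoPointC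

/-- **Variance combination (pure real arithmetic).** From the bare size `c₈ ≤ β·t` with `0 < c₈` and `1 ≤ β`, and the
bare variance ceiling `V ≤ C₃·(β²)⁻¹`: `V ≤ (max C₃ 0 / c₈²)·t²`. Indeed `c₈² ≤ β²·t²` gives `(β²)⁻¹ ≤ t²/c₈²`, and
`C₃ ≤ max C₃ 0` with `0 ≤ max C₃ 0` lets the two bounds be chained. [folklore] -/
private theorem variance_combine {V C₃ c₈ β t : ℝ} (hc₈ : 0 < c₈) (hβ : 1 ≤ β)
    (hbare : c₈ ≤ β * t) (hV : V ≤ C₃ * (β ^ 2)⁻¹) :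
    V ≤ max C₃ 0 / c₈ ^ 2 * t ^ 2 := by
  have hβpos : 0 < β := one_pos.trans_le hβ
  have hβ2 : 0 < β ^ 2 := pow_pos hβpos 2
  have hc2 : 0 < c₈ ^ 2 := pow_pos hc₈ 2
  -- square the bare size: `c₈² ≤ (β·t)² = β²·t²`
  have hsq : c₈ ^ 2 ≤ β ^ 2 * t ^ 2 := by
    rw [← mul_pow]
    exact pow_le_pow_left₀ hc₈.le hbare 2
  -- hence `1/β² ≤ t²/c₈²`
  have hinv : (β ^ 2)⁻¹ ≤ t ^ 2 / c₈ ^ 2 := by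
    rw [inv_eq_one_div, div_le_div_iff₀ hβ2 hc2]
    linarith [hsq]
  calc V ≤ C₃ * (β ^ 2)⁻¹ := hV
    _ ≤ max C₃ 0 * (β ^ 2)⁻¹ := mul_le_mul_of_nonneg_right (le_max_left _ _) (inv_nonneg.mpr hβ2.le)
    _ ≤ max C₃ 0 * (t ^ 2 / c₈ ^ 2) := mul_le_mul_of_nonneg_left hinv (le_max_right _ _)
    _ = max C₃ 0 / c₈ ^ 2 * t ^ 2 := by ring

/-- **V ⟸ bare variance ceiling + bare size (line `birth` reshape, lead c9, wave 1; sorry-free bridge).**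
For a compact group `G`, a lattice representation `r`, and a GIVEN box coupling `u : ℕ → ℝ → ℝ` with constants
`u₀ β₀ κ₁ κ₂ κ₃ c C c₈` carrying the R-bundle `hR` (admissibility, continuity, freezing, BARE SIZE `c₈ ≤ β·u(8,β)` for
`β ≥ β₀` with `0 < c₈`, in-window comparability, dyadic AF step law, and diagonal matching on window boxes; verbatim the
antecedent of the registered `stub_varianceCeiling`), the `u`-free BARE VARIANCE CEILING `hVB`
(`Var_{L,β}(P_0^{01}) = E(P_0^{01}·P_0^{01}) - E(P_0^{01})² ≤ C₃·(β²)⁻¹` for `β ≥ β₂`, `L ≥ 8`, with `P` the plaquette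
field `x i j U ↦ N - Re tr ρ(U_{x,ij})` and `E` the Wilson expectation at coupling `β`) implies V's conclusion: there are
`β₁ C'` with `Var_{L,β}(P_0^{01}) ≤ C'·u(8,β)²` on window boxes `L ≥ 8` beyond `β₁`.
Witnesses: `β₁ = max β₀ (max β₂ 1)`, `C' = max C₃ 0 / c₈²`. Only the clause `0 < c₈` and the bare-size clause of `hR` are
used; the window hypothesis is not used. Stated in `∀`-form (the shape registered as a sub-goal stub of
stmt-QuantumFields-16204, so that the `--supports` landing passes `supports.stub-mismatch`); use as
`varianceCeiling_of_bareVariance r u u₀ β₀ κ₁ κ₂ κ₃ c C c₈ hR hVB`. [folklore] -/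
theorem varianceCeiling_of_bareVariance :
    ∀ {G : Type} [Group G] [TopologicalSpace G] [IsTopologicalGroup G] [CompactSpace G]
        [MeasurableSpace G] [BorelSpace G] (r : LatticeRep G) (u : ℕ → ℝ → ℝ) (u₀ β₀ κ₁ κ₂ κ₃ c C c₈ : ℝ),
      (0 < u₀ ∧ 0 < c ∧ 0 < κ₁ ∧ 0 ≤ κ₃ ∧ 0 < c₈ ∧
        (∀ (L : ℕ) (β : ℝ), 8 ≤ L → β₀ ≤ β → 0 < u L β) ∧
        (∀ L : ℕ, 8 ≤ L → ContinuousOn (u L) (Set.Ici β₀)) ∧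
        (∀ L : ℕ, 8 ≤ L → Filter.Tendsto (u L) Filter.atTop (nhds 0)) ∧
        (∀ β : ℝ, β₀ ≤ β → c₈ ≤ β * u 8 β) ∧
        (∀ (L L' : ℕ) (β : ℝ), β₀ ≤ β → 8 ≤ L → L ≤ L' → L' ≤ 2 * L →
            (∀ M : ℕ, 8 ≤ M → M ≤ L → u M β ≤ u₀) → |(u L β)⁻¹ - (u L' β)⁻¹| ≤ κ₂) ∧
        (∀ (k m : ℕ) (β : ℝ), β₀ ≤ β → (∀ M : ℕ, 8 ≤ M → M ≤ 8 * 2 ^ (k + m) → u M β ≤ u₀) →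
            κ₁ * m - κ₃ ≤ (u (8 * 2 ^ k) β)⁻¹ - (u (8 * 2 ^ (k + m)) β)⁻¹ ∧
              (u (8 * 2 ^ k) β)⁻¹ - (u (8 * 2 ^ (k + m)) β)⁻¹ ≤ κ₂ * m + κ₃) ∧
        (∀ (L : ℕ) [NeZero L] (β : ℝ), β₀ ≤ β → 8 ≤ L →
            (∀ M : ℕ, 8 ≤ M → M ≤ L → u M β ≤ u₀) →
            ∀ (P : (Fin 4 → ZMod L) → Fin 4 → Fin 4 → GaugeConfig 4 L G → ℝ)
              (E : (GaugeConfig 4 L G → ℝ) → ℝ),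
              (P = fun x i j U => (r.N : ℝ) - (r.ρ (plaquetteHolonomy U x i j)).trace.re) →
              (E = fun F => wilsonExpectation r.ρ β F) →
              c * u L β ^ 2 ≤
                ((L / 8 : ℕ) : ℝ) ^ 8 * (E (fun U => P 0 0 1 U * P (Pi.single (2 : Fin 4) ((L / 8 : ℕ) : ZMod L)) 0 1 U)
                  - E (P 0 0 1) * E (P (Pi.single (2 : Fin 4) ((L / 8 : ℕ) : ZMod L)) 0 1)) ∧
              ((L / 8 : ℕ) : ℝ) ^ 8 * (E (fun U => P 0 0 1 U * P (Pi.single (2 : Fin 4) ((L / 8 : ℕ) : ZMod L)) 0 1 U)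
                - E (P 0 0 1) * E (P (Pi.single (2 : Fin 4) ((L / 8 : ℕ) : ZMod L)) 0 1)) ≤ C * u L β ^ 2)) →
      (∃ (β₂ C₃ : ℝ), ∀ (L : ℕ) [NeZero L] (β : ℝ), β₂ ≤ β → 8 ≤ L →
            ∀ (P : (Fin 4 → ZMod L) → Fin 4 → Fin 4 → GaugeConfig 4 L G → ℝ)
              (E : (GaugeConfig 4 L G → ℝ) → ℝ),
              (P = fun x i j U => (r.N : ℝ) - (r.ρ (plaquetteHolonomy U x i j)).trace.re) →
              (E = fun F => wilsonExpectation r.ρ β F) →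
              E (fun U => P 0 0 1 U * P 0 0 1 U) - E (P 0 0 1) * E (P 0 0 1) ≤ C₃ * (β ^ 2)⁻¹) →
      ∃ (β₁ C' : ℝ),
        (∀ (L : ℕ) [NeZero L] (β : ℝ), β₁ ≤ β → 8 ≤ L → (∀ M : ℕ, 8 ≤ M → M ≤ L → u M β ≤ u₀) →
            ∀ (P : (Fin 4 → ZMod L) → Fin 4 → Fin 4 → GaugeConfig 4 L G → ℝ)
              (E : (GaugeConfig 4 L G → ℝ) → ℝ),
              (P = fun x i j U => (r.N : ℝ) - (r.ρ (plaquetteHolonomy U x i j)).trace.re) →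
              (E = fun F => wilsonExpectation r.ρ β F) →
              E (fun U => P 0 0 1 U * P 0 0 1 U) - E (P 0 0 1) * E (P 0 0 1) ≤ C' * u 8 β ^ 2) := by
  intro G _ _ _ _ _ _ r u u₀ β₀ κ₁ κ₂ κ₃ c C c₈ hR hVB
  obtain ⟨β₂, C₃, hvb⟩ := hVB
  obtain ⟨-, -, -, -, hc₈, -, -, -, hbare, -, -, -⟩ := hR
  refine ⟨max β₀ (max β₂ 1), max C₃ 0 / c₈ ^ 2, ?_⟩
  intro L _ β hβ hL _ P E hP hE
  have hβ₀ : β₀ ≤ β := (le_max_left _ _).trans hβ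
  have hβ₂ : β₂ ≤ β := ((le_max_left _ _).trans (le_max_right _ _)).trans hβ
  have hβ1 : (1 : ℝ) ≤ β := ((le_max_right _ _).trans (le_max_right _ _)).trans hβ
  -- the bare variance ceiling on the box `L` at coupling `β ≥ β₂`
  have hvar := hvb L β hβ₂ hL P E hP hE
  -- the bare size at `β ≥ β₀`
  have hbs : c₈ ≤ β * u 8 β := hbare β hβ₀
  exact variance_combine hc₈ hβ1 hbs hvar

end Summit.QuantumFields.YangMills.Theorems.FemtoCurvatureTwoPointC

end
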